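import Literature.MathematicalPhysics.QuantumFieldTheory.Balaban1983to89.B6Partition118KLevelFineSecondL0
import Literature.MathematicalPhysics.QuantumFieldTheory.Balaban1983to89.B6Partition118KLevelFineLip
/-!
# `Balaban1983to89.B6Partition118KLevelFineLipL0` — LEVEL-0 TWIN (programme G-F3′-L0, director-ym LINE №27 / UV3-NODE §24.5; plan `lit-balaban-r03/G-F3L0-PLAN.md`) of `B6Partition118KLevelFineLip`:
the same declarations, SAME NAMES AND STATEMENTS, for nested families WITH print's region `Λ₀ = T ∖ Ω₁` ADMITTED (structures
`B6MultiLevelBoxOperatorL0.Domains` / `B6MultiLevelTorusOperatorL0.TDomains`: levels `0, …, k`, the level-`0` block a single site, `Q′₀ = id`,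
finite weight `a₀` — print p.225 (2.14) «Σ_{j=0}^k … (Q′₀λ)(x) = λ(x), x ∈ Λ₀», p.229 «taking a sequence (2.1) … smallest possible domains B^j(Λ_j),
and considering the operator Δ_a defined by (2.19), (2.20) for this sequence»).  Every `D`-free object is the lineage's, consumed BY NAME; no existing
module is touched; no fact is minted.  Unit `lit-balaban-r03` (B6 fold owner, r03 gen 36); referee ref-4.  THE TWIN'S DOCUMENTATION FOLLOWS
VERBATIM (its «levels 1 … k» / «Ω₁ = X» sentences describe the twin; here `j` runs from `0` and `Ω₁` may be a proper subset).

# `Balaban1983to89.B6Partition118KLevelFineLip` — T. Bałaban, *Propagators and renormalization transformations for lattice gauge theories. II*,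
# Commun. Math. Phys. **96** (1984) 223–250 [Balaban1984PropagatorsII], p. 229 (2.36), p. 239 (2.89)–(2.92), p. 247 (2.134): THE SMOOTH FINE-LATTICE
# PARTITION `{h_□}` IN THE DISTANCE (2.46) — **`|h_□(x′) − h_□(x)| ≤ (s/M)(d(y(x), y(x′)) + 1)`**, the cut-offs `ζ_□` (indicator of the blocks of
# `□̃ = {|cen y − ctr|_∞ ≤ 7S/4}`), **the gap `d(y, y″) ≥ M/(4L)` between the outside of `□̃` and the blocks carrying `supp h_□`**, and THE PACKAGE of the
# `h_□`/`ζ_□` hypotheses of the (2.134)/(2.91) gluing (`…B6Ineq2134KFamKLevel.h2134_kFam_kLevel`) on the fine box of a genuine nested family (file 4)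

statement-level skeleton of published theorems with citation tags; proofs where landed; nothing here is a claim about the Yang–Mills mass gap

PDF held: `paper:balaban1984-cmp96-propagators-rt-ii` (journal page = PDF page + 222): p. 229 [PDF 7], p. 231 [PDF 9] ((2.46)), p. 237 [PDF 15] ((2.83)–(2.85)),
p. 239 [PDF 17], p. 247 [PDF 25]; read from the tree transcriptions (`…B6Cover236MultiLevelBlocks`, `…B6Geom246MultiLevelBox`, `…B6Ineq2134Diag`).
PRINT p. 239 before (2.89): *"Let us take the partition of unity {h_□²}_{□∈𝒟} and the corresponding family of functions ζ_□ ∈ C₀^∞(□̃), and let us define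
G₀ = Σ_□ h_□G_□h_□ (2.89)"*; p. 247: *"Let us notice that h_□′(x′) − h_□′(x) can be estimated by O(1)M^{−1}d(y,y′) … and ζ_□(y) − 1 = 0 for d(y, y′) ≤ M,
y′ ∈ □′"* — the Lipschitz bound of `h_□` IN `d` and the gap between `{ζ_□ ≠ 1}` and `supp h_□` are the two geometric inputs of (2.134).

CITATION HEADER (lean-in-tree rule) — WHAT IS REPRODUCED.  Phase-2 file of the `lit-balaban` typed skeleton (HOME `run/shared/lean/pub/lit-balaban/`), seat
**p38 gen 25**; offer (1) of B6-CLOSURE §5 item 7 (owner r03 g18, 2026-08-22T22:35:35Z), FILE 4; SKELETON rows **B6.Eq2.36** × **B6.Eq2.134** × **B6.Eq2.91**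
(cells only; decls of record untouched; referee ref-4).  Files 1–3 (`…B6Partition118KLevelFine`, `…Sizes`, `…Second`) built `hF` and its sizes in the
sup metric of the fine lattice.  THIS FILE converts to the distance (2.46) `d = (geom D).dist` of p21's `…B6Geom246MultiLevelBox` between the BLOCKS
`y(x) = blkOf D x` and packages the binders (`M = L·M_h`, `L = ℓ + 1 ≥ 2`, `M_h ≥ 2`, `R ≥ 2L`, box sides `P_μ ≥ 1`):
* §1 **`abs_hF_sub_le_geom`**: `|hF □ x′ − hF □ x| ≤ sLipF d ℓ/(L·M_h)·(d(y(x), y(x′)) + 1)`, `sLipF = 2L³ + (5/8)·C1F·L` — p21's near/far mechanism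
  (`disp_or_far`: the shortest admissible chain from a block of `□⁺` either has sup-displacement `≤ d·L^{j+1}` or exits to `B^{j+2}`, which is far by
  (2.2)) at the threshold `S/(2L²)`: far pairs by `0 ≤ h ≤ 1`, near pairs by file 2's `abs_hF_sub_le_of_dist_le`; the `+1` (`r₀ = 1` of the consumer)
  absorbs the positions of the two sites inside their blocks (print's bound is stated between block variables `y, y′`);
* §2 the cut-off blocks `Qbig D □ = {y : |cen y − ctr_□|_∞ ≤ 7S/4}` (print's `□̃`), `zetaB D □ x = 𝟙[y(x) ∈ Qbig]` (`0 ≤ ζ ≤ 1`, `ζ ≠ 1 ⇒ y(x) ∉ Qbig`),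
  `Q ⊆ Qbig`, and **the gap** `gap_Qbig`: `y ∉ Qbig D □`, `y″ ∈ Q D □` ⟹ `(1/(4L))·(L·M_h) ≤ d(y, y″)` (p21's `gap_core`);
* §3 **`partition118_fine`**: the package — `Σ_□ hF² = 1`, `|hF| ≤ 1`, `hF □ x ≠ 0 ⇒ y(x) ∈ Q D □`, the `d`-Lipschitz bound, `ζ ∈ [0,1]`, `ζ ≠ 1 ⇒ ∉ Qbig`,
  the gap, and the fine-step sizes `C1F/(8S/5)`, `C2F/(8S/5)²` of files 2–3 — the shapes of the binders `h236`/`hh1`/`hhS`/`hLip`/`hζ0`/`hζ1`/`hζS`/`hgap`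
  (+ the raw material of `hcf`/`hc₀`) of `…B6Ineq2134KFamKLevel.h2134_kFam_kLevel` with `S_□ := Q D □`, `Score_□ := Qbig D □`, `s := sLipF`, `r₀ := 1`,
  `m := 1/(4L)`, for every `D : Domains d ℓ M_h k P R` (the k-level census member `i : KIdx d ℓ` has `D := i.D`; the lift to vector fields
  `(x, μ) ↦ hF D □ x` is the consumer's one-liner).
No new fact; defs `sLipF`, `Qbig`, `zetaB` with bodies; standard axioms.
HONEST SCOPE. As files 1–3 (normalisation across levels ours; constants `L`,`d`-dependent, `k`,`M_h`-independent); `ζ_□` here is the indicator of a union of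
BLOCKS (print: `ζ_□ ∈ C₀^∞(□̃)` — no derivative of `ζ_□` enters (2.92)/(2.134), cell decision r03 g18 22:35:35Z); the set `T_□ ⊇ S_□` on which the local
propagator's majorant holds is the G-side's (B6-CLOSURE item 7 (d1)/(d3)), not fixed here.  Integer box; nothing on d = 4 or the continuum; NOT summit
progress.  Unit `lit-balaban-p38` (gen 25), 2026-08-22.
-/

namespace Literature.MathematicalPhysics.QuantumFieldTheory.Balaban1983to89.B6Partition118KLevelFineLipL0

open Finset
open Literature.MathematicalPhysics.QuantumFieldTheory.Balaban1983to89.B4ContourShift (supNorm)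
open Literature.MathematicalPhysics.QuantumFieldTheory.Balaban1983to89.B4Reflection242 (boxDom mem_boxDom blk)
open Literature.MathematicalPhysics.QuantumFieldTheory.Balaban1983to89.B6MultiLevelBoxOperator hiding Domains mlOp_apply
open Literature.MathematicalPhysics.QuantumFieldTheory.Balaban1983to89.B6MultiLevelBoxOperatorL0
open Literature.MathematicalPhysics.QuantumFieldTheory.Balaban1983to89.B6Geom246MultiLevelBox hiding Touch blkOf blkOf_corner blkOf_eq_iff_blk blkOf_eq_of_blk_i_eq blkOf_val bond bond_adj bset cen connected coord_bounds corner corner_mem csys dist_blkOf_le_box dist_blkOf_le_coord dist_blkOf_le_line dist_cen_le_of_adj dist_cen_le_of_touch dist_le_one_of_near dist_toR_cen_le exists_blkOf_eq geom lemma21_box lev_corner lev_eq_of_blkOf_eq levelGap pack reachable_blkOf reachable_of_near realizes scale_bounds touch_symm triangle_refl_nonneg walk_disp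
open Literature.MathematicalPhysics.QuantumFieldTheory.Balaban1983to89.B6Geom246MultiLevelBoxL0
open Literature.MathematicalPhysics.QuantumFieldTheory.Balaban1983to89.B6Cover236MultiLevelBlocksL0 (cubes side side_eq side_pos ctr Q mem_Q window disp_or_far gap_core)
open Literature.MathematicalPhysics.QuantumFieldTheory.Balaban1983to89.B6Partition118KLevelFineL0 (sF sF_pos thetaF hF hF_nonneg hF_le_one abs_hF_le_one sum_hF_sq dist_lt_of_hF_ne_zero lev_window_of_dist_lt blkOf_mem_Q_of_hF_ne_zero)
open Literature.MathematicalPhysics.QuantumFieldTheory.Balaban1983to89.B6Partition118KLevelFineSizes (C1F C1F_nonneg)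
open Literature.MathematicalPhysics.QuantumFieldTheory.Balaban1983to89.B6Partition118KLevelFineSizesL0 (abs_hF_sub_le_of_dist_le abs_hF_sub_le_near)
open Literature.MathematicalPhysics.QuantumFieldTheory.Balaban1983to89.B6Partition118KLevelFineSecond (C2F)
open Literature.MathematicalPhysics.QuantumFieldTheory.Balaban1983to89.B6Partition118KLevelFineSecondL0 (abs_hF_second_diff_le)
open Literature.MathematicalPhysics.QuantumFieldTheory.Balaban1983to89.B6Partition118KLevelFineLip (sLipF sLipF_nonneg)

variable {d : ℕ} {ℓ Mh k R : ℕ} {P : Fin (d + 1) → ℕ} (D : Domains d ℓ Mh k P R)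

/-! ## §1  The Lipschitz bound of `h_□` in the distance (2.46) -/

/-- the one-sided bound (at a site where `h_□ ≠ 0`), in the bond count of the shortest admissible chain.
[cite: Balaban1984PropagatorsII, p.247 with (2.46) p.231 and (2.2) p.224, bookkeeping] -/
theorem abs_hF_sub_le_geom_aux (hℓ : 1 ≤ ℓ) (hMh : 2 ≤ Mh) (hP : ∀ μ, 1 ≤ P μ) (hR : 2 * (ℓ + 1) ≤ R) {i : ↥(B6Cover236MultiLevelBlocksL0.cubes D)}
    {x x'' : ↥(boxDom (N0 ℓ Mh k P))} (hne : hF D i x'' ≠ 0) :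
    |hF D i x - hF D i x''| ≤ sLipF d ℓ / (((ℓ : ℝ) + 1) * Mh) * (((bond D).dist (blkOf D x'') (blkOf D x) : ℝ) + 1) := by
  have hMh1 : 1 ≤ Mh := le_trans (by norm_num) hMh
  have hS := side_pos D hMh1 i
  have hL1 : (1 : ℝ) ≤ (ℓ : ℝ) := by exact_mod_cast hℓ
  have hL0 : (0 : ℝ) < (ℓ : ℝ) + 1 := by linarith
  have hL4 : (4 : ℝ) ≤ ((ℓ : ℝ) + 1) ^ 2 := by nlinarith
  have hMr : (2 : ℝ) ≤ Mh := by exact_mod_cast hMh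
  have hC1 := C1F_nonneg d ℓ
  have eS : side D i = (((ℓ + 1) ^ (i.1.1 + 1) : ℕ) : ℝ) * Mh := side_eq D i
  set Lp : ℝ := (((ℓ + 1) ^ (i.1.1 + 1) : ℕ) : ℝ) with hLp
  have hLp0 : 0 < Lp := by positivity
  set y := blkOf D x with hy
  set y'' := blkOf D x'' with hy''
  set n : ℝ := ((bond D).dist y'' y : ℝ) with hn
  have hn0 : 0 ≤ n := by positivity
  have hy''Q : y'' ∈ Q D i := blkOf_mem_Q_of_hF_ne_zero D hMh hR hne
  have hθ'' := dist_lt_of_hF_ne_zero D hMh1 hne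
  have h01 : |hF D i x - hF D i x''| ≤ 1 := by
    rw [abs_sub_le_iff]
    constructor <;> linarith [hF_nonneg D i x, hF_nonneg D i x'', hF_le_one D hMh1 i x, hF_le_one D hMh1 i x'']
  -- `s/(L M_h) ≥ 2L²/M_h` and `≥ (5/8)C1F/M_h`
  have hM0 : (0 : ℝ) ≤ Mh := by positivity
  have hP1 : 0 ≤ 5 / 8 * C1F d ℓ * ((ℓ : ℝ) + 1) * Mh := by positivity
  have hP2 : 0 ≤ 2 * ((ℓ : ℝ) + 1) ^ 3 * Mh := by positivity
  have hsA : 2 * ((ℓ : ℝ) + 1) ^ 2 / Mh ≤ sLipF d ℓ / (((ℓ : ℝ) + 1) * Mh) := by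
    rw [div_le_div_iff₀ (by positivity) (by positivity)]; unfold sLipF
    have e : (2 * ((ℓ : ℝ) + 1) ^ 3 + 5 / 8 * C1F d ℓ * ((ℓ : ℝ) + 1)) * Mh =
        2 * ((ℓ : ℝ) + 1) ^ 2 * (((ℓ : ℝ) + 1) * Mh) + 5 / 8 * C1F d ℓ * ((ℓ : ℝ) + 1) * Mh := by ring
    rw [e]; linarith
  have hsB : 5 / 8 * C1F d ℓ / Mh ≤ sLipF d ℓ / (((ℓ : ℝ) + 1) * Mh) := by
    rw [div_le_div_iff₀ (by positivity) (by positivity)]; unfold sLipF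
    have e : (2 * ((ℓ : ℝ) + 1) ^ 3 + 5 / 8 * C1F d ℓ * ((ℓ : ℝ) + 1)) * Mh =
        2 * ((ℓ : ℝ) + 1) ^ 3 * Mh + 5 / 8 * C1F d ℓ * (((ℓ : ℝ) + 1) * Mh) := by ring
    rw [e]; linarith
  by_cases hfar : side D i / (2 * ((ℓ : ℝ) + 1) ^ 2) ≤ (n + 1) * Lp
  · -- far pairs: `|Δh| ≤ 1 ≤ 2L²(n+1)/M_h`
    have hMn : (Mh : ℝ) ≤ 2 * ((ℓ : ℝ) + 1) ^ 2 * (n + 1) := by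
      rw [eS, div_le_iff₀ (by positivity)] at hfar
      by_contra hlt
      push Not at hlt
      have : 2 * ((ℓ : ℝ) + 1) ^ 2 * (n + 1) * Lp < Mh * Lp := mul_lt_mul_of_pos_right hlt hLp0
      nlinarith
    calc |hF D i x - hF D i x''| ≤ 1 := h01
      _ ≤ 2 * ((ℓ : ℝ) + 1) ^ 2 / Mh * (n + 1) := by
          rw [div_mul_eq_mul_div, le_div_iff₀ (by positivity), one_mul]; exact hMn
      _ ≤ sLipF d ℓ / (((ℓ : ℝ) + 1) * Mh) * (n + 1) := mul_le_mul_of_nonneg_right hsA (by positivity)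
  · push Not at hfar
    -- near pairs: the displacement of the blocks is `≤ n·L^{j+1}`, both blocks lie in `□⁺`, so both sites are within `(n+1)L^{j+1}` in the sup metric
    have hS8 : side D i / (2 * ((ℓ : ℝ) + 1) ^ 2) ≤ side D i / 8 := div_le_div_of_nonneg_left hS.le (by norm_num) (by nlinarith)
    have hR1 : (2 : ℝ) * ((ℓ : ℝ) + 1) ≤ R := by exact_mod_cast hR
    have hRL : (8 : ℝ) ≤ (R : ℝ) * ((ℓ : ℝ) + 1) := by nlinarith
    have hdisp : dist (cen D y'') (cen D y) ≤ n * Lp := by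
      rcases disp_or_far D hMh1 hP hR hy''Q (y := y) with h | h
      · exact h
      · exfalso; nlinarith
    have hlev'' : (((ℓ + 1) ^ y''.1.1 : ℕ) : ℝ) ≤ Lp := by
      have := (lev_window_of_dist_lt D hMh1 hR hθ'').2
      have hnat : (ℓ + 1) ^ y''.1.1 ≤ (ℓ + 1) ^ (i.1.1 + 1) :=
        Nat.pow_le_pow_right (by omega) (by show (blkOf D x'').1.1 ≤ i.1.1 + 1; exact this)
      rw [hLp]; exact_mod_cast hnat
    have hc'' : dist (toR x''.1) (cen D y'') ≤ (Lp - 1) / 2 := (dist_toR_cen_le D rfl).trans (by linarith)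
    have hyQ : y ∈ Q D i := (mem_Q D).2 (by
      have h1 := dist_triangle (cen D y) (cen D y'') (ctr D i)
      have h2 := dist_triangle (cen D y'') (toR x''.1) (ctr D i)
      rw [dist_comm (cen D y) (cen D y'')] at h1
      rw [dist_comm (cen D y'') (toR x''.1)] at h2
      nlinarith)
    have hlev : (((ℓ + 1) ^ y.1.1 : ℕ) : ℝ) ≤ Lp := by
      have := (window D hMh1 hR hyQ).2
      have hnat : (ℓ + 1) ^ y.1.1 ≤ (ℓ + 1) ^ (i.1.1 + 1) := Nat.pow_le_pow_right (by omega) this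
      rw [hLp]; exact_mod_cast hnat
    have hc : dist (toR x.1) (cen D y) ≤ (Lp - 1) / 2 := (dist_toR_cen_le D rfl).trans (by linarith)
    have hρ : dist (toR x''.1) (toR x.1) ≤ (n + 1) * Lp := by
      have h1 := dist_triangle (toR x''.1) (cen D y'') (toR x.1)
      have h2 := dist_triangle (cen D y'') (cen D y) (toR x.1)
      rw [dist_comm (cen D y) (toR x.1)] at h2
      nlinarith
    have key := abs_hF_sub_le_of_dist_le D hℓ hMh1 hR i hρ hfar.le
    -- `C1F·(n+1)L^{j+1}/(8S/5) = (5/8)·C1F·(n+1)/M_h`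
    have e : C1F d ℓ * ((n + 1) * Lp) / sF D i = 5 / 8 * C1F d ℓ / Mh * (n + 1) := by
      unfold sF; rw [eS]; field_simp
    rw [e] at key
    exact key.trans (mul_le_mul_of_nonneg_right hsB (by positivity))

/-- **THE LIPSCHITZ BOUND OF `h_□` IN THE DISTANCE (2.46)** at fine sites (the binder `hLip` with `s := sLipF d ℓ`, `M := L·M_h`, `r₀ := 1`):
`|h_□(x′) − h_□(x)| ≤ (s/M)·(d(y(x), y(x′)) + 1)` («h_□′(x′) − h_□′(x) can be estimated by O(1)M^{−1}d(y,y′)»; the `+1` covers two sites of one block).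
[cite: Balaban1984PropagatorsII, p.247 after (2.134); (2.84)–(2.85) p.237] -/
theorem abs_hF_sub_le_geom (hℓ : 1 ≤ ℓ) (hMh : 2 ≤ Mh) (hP : ∀ μ, 1 ≤ P μ) (hR : 2 * (ℓ + 1) ≤ R) (i : ↥(B6Cover236MultiLevelBlocksL0.cubes D))
    (x x' : ↥(boxDom (N0 ℓ Mh k P))) :
    |hF D i x' - hF D i x| ≤ sLipF d ℓ / (((ℓ : ℝ) + 1) * Mh) * ((geom D).dist (blkOf D x) (blkOf D x') + 1) := by
  have e1 : (geom D).dist (blkOf D x) (blkOf D x') = ((bond D).dist (blkOf D x) (blkOf D x') : ℝ) := rfl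
  by_cases h : hF D i x ≠ 0
  · rw [e1, SimpleGraph.dist_comm]
    simpa only [SimpleGraph.dist_comm] using abs_hF_sub_le_geom_aux D hℓ hMh hP hR (x := x') h
  · by_cases h' : hF D i x' ≠ 0
    · rw [abs_sub_comm, e1, SimpleGraph.dist_comm]
      exact abs_hF_sub_le_geom_aux D hℓ hMh hP hR (x := x) h'
    · push Not at h h'
      rw [h, h', sub_self, abs_zero, e1]
      exact mul_nonneg (div_nonneg (sLipF_nonneg d ℓ) (by positivity)) (by positivity)

/-! ## §2  The cut-off blocks `□̃`, `ζ_□`, and the gap -/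

/-- **`□̃` AS A SET OF BLOCKS**: the blocks whose centre is within `7S/4` of the centre of □ (print: the cube `□̃` *"of the size 4M"* around □).
[cite: Balaban1984PropagatorsII, p.239 («ζ_□ ∈ C₀^∞(□̃)»), p.235] -/
noncomputable def Qbig (i : ↥(cubes D)) : Finset ↥(bset D) :=
  Finset.univ.filter fun y => dist (cen D y) (ctr D i) ≤ 7 / 4 * side D i

/-- membership in `□̃`. [cite: Balaban1984PropagatorsII, p.239, dictionary] -/
theorem mem_Qbig {i : ↥(cubes D)} {y : ↥(bset D)} : y ∈ Qbig D i ↔ dist (cen D y) (ctr D i) ≤ 7 / 4 * side D i := by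
  unfold Qbig; rw [Finset.mem_filter]; exact ⟨fun h => h.2, fun h => ⟨Finset.mem_univ _, h⟩⟩

/-- `□⁺ ⊆ □̃`. [cite: Balaban1984PropagatorsII, p.239, bookkeeping] -/
theorem Q_subset_Qbig (hMh : 1 ≤ Mh) (i : ↥(cubes D)) : Q D i ⊆ Qbig D i := fun y hy =>
  (mem_Qbig D).2 (((mem_Q D).1 hy).trans (by have := side_pos D hMh i; linarith))

open Classical in
/-- **`ζ_□`** at fine sites: the indicator of the blocks of `□̃` (the binder `ζ`; no derivative of `ζ_□` enters (2.92)/(2.134)).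
[cite: Balaban1984PropagatorsII, p.239 («the corresponding family of functions ζ_□»)] -/
noncomputable def zetaB (i : ↥(cubes D)) (x : ↥(boxDom (N0 ℓ Mh k P))) : ℝ := if blkOf D x ∈ Qbig D i then 1 else 0

/-- `ζ ≥ 0`. [cite: Balaban1984PropagatorsII, p.239, bookkeeping] -/
theorem zetaB_nonneg (i : ↥(cubes D)) (x : ↥(boxDom (N0 ℓ Mh k P))) : 0 ≤ zetaB D i x := by
  unfold zetaB; split_ifs <;> norm_num

/-- `ζ ≤ 1`. [cite: Balaban1984PropagatorsII, p.239, bookkeeping] -/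
theorem zetaB_le_one (i : ↥(cubes D)) (x : ↥(boxDom (N0 ℓ Mh k P))) : zetaB D i x ≤ 1 := by
  unfold zetaB; split_ifs <;> norm_num

/-- `ζ_□(x) ≠ 1 ⟹ y(x) ∉ □̃` (the binder `hζS` with `Score_□ := □̃`). [cite: Balaban1984PropagatorsII, p.247 («ζ_□(y) − 1 = 0 for d(y,y′) ≤ M»)] -/
theorem not_mem_Qbig_of_zetaB_ne_one {i : ↥(cubes D)} {x : ↥(boxDom (N0 ℓ Mh k P))} (h : zetaB D i x ≠ 1) : blkOf D x ∉ Qbig D i := by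
  intro hx; apply h; unfold zetaB; rw [if_pos hx]

/-- `ζ_□(x) = 1` on the blocks of `□̃`. [cite: Balaban1984PropagatorsII, p.247, bookkeeping] -/
theorem zetaB_eq_one {i : ↥(cubes D)} {x : ↥(boxDom (N0 ℓ Mh k P))} (h : blkOf D x ∈ Qbig D i) : zetaB D i x = 1 := by
  unfold zetaB; rw [if_pos h]

/-- `ζ_□·h_□ = h_□` (`ζ_□ = 1` on `supp h_□`, `M_h ≥ 2`). [cite: Balaban1984PropagatorsII, p.239 (2.91) («ζ_□h_□ = h_□»), bookkeeping] -/
theorem zetaB_mul_hF (hMh : 2 ≤ Mh) (hR : 2 * (ℓ + 1) ≤ R) (i : ↥(cubes D)) (x : ↥(boxDom (N0 ℓ Mh k P))) :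
    zetaB D i x * hF D i x = hF D i x := by
  by_cases h : hF D i x = 0
  · rw [h, mul_zero]
  · rw [zetaB_eq_one D (Q_subset_Qbig D (le_trans (by norm_num) hMh) i (blkOf_mem_Q_of_hF_ne_zero D hMh hR h)), one_mul]

/-- **THE GAP** (the binder `hgap` with `Score_□ := □̃`, `S_□ := □⁺`, `m := 1/(4L)`, `M := L·M_h`): a block outside `□̃` and a block of `□⁺` are at
distance `d ≥ M_h/4` — their centres are `> S/2` apart in the sup metric, and p21's `gap_core` (the shortest chain covers it at `≤ L^{j+1}` per bond or
exits to `B^{j+2}`). [cite: Balaban1984PropagatorsII, p.247 («ζ_□(y) − 1 = 0 for d(y, y′) ≤ M, y′ ∈ □′»), (2.83) p.237] -/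
theorem gap_Qbig (hMh : 1 ≤ Mh) (hP : ∀ μ, 1 ≤ P μ) (hR : 2 * (ℓ + 1) ≤ R) {i : ↥(cubes D)} {y y'' : ↥(bset D)}
    (hy : y ∉ Qbig D i) (hy'' : y'' ∈ Q D i) : 1 / (4 * ((ℓ : ℝ) + 1)) * (((ℓ : ℝ) + 1) * Mh) ≤ (geom D).dist y y'' := by
  have hS := side_pos D hMh i
  rw [mem_Qbig] at hy
  push Not at hy
  have hQ := (mem_Q D).1 hy''
  have hfar : side D i / 4 < dist (cen D y'') (cen D y) := by
    have := dist_triangle (cen D y) (cen D y'') (ctr D i)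
    rw [dist_comm (cen D y) (cen D y'')] at this
    linarith
  have hcore := gap_core D hMh hP hR hy'' hfar
  have e : (geom D).dist y y'' = ((bond D).dist y'' y : ℝ) := by
    show (((bond D).dist y y'' : ℕ) : ℝ) = _; rw [SimpleGraph.dist_comm]
  rw [e]
  have hL : (0 : ℝ) < (ℓ : ℝ) + 1 := by positivity
  have e2 : 1 / (4 * ((ℓ : ℝ) + 1)) * (((ℓ : ℝ) + 1) * Mh) = (Mh : ℝ) / 4 := by field_simp
  rw [e2]; exact hcore.le

/-! ## §3  The package -/

/-- **THE SMOOTH PARTITION (1.118)/(2.36) ON THE FINE LATTICE WITH ITS CUT-OFFS AND CONSTANTS**, uniformly in `k`, `M_h ≥ 2L` (LEVEL-0 JOINT of G-F3′-L0: the twin has `M_h ≥ 2`; the fine-step size needs `2L² ≤ S` also for the level-`0` cubes of side `L·M_h`), `P` (`P_μ ≥ 1`), `D`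
(`L ≥ 2`, `R ≥ 2L`): `Σ_□ h_□² = 1`; `|h_□| ≤ 1`; `supp h_□` within the blocks of `□⁺ = Q D □`; the Lipschitz bound `(s/M)(d + 1)` in the distance
(2.46); `0 ≤ ζ_□ ≤ 1`, `ζ_□ ≠ 1 ⇒` outside `□̃ = Qbig D □`; the gap `(1/(4L))·M ≤ d(y, y″)` for `y ∉ □̃`, `y″ ∈ □⁺`; and the fine-step sizes
`|h_□(x′) − h_□(x)| ≤ C1F/(8S/5)` (sup-distance `≤ 1`), `|h_□(x + e_μ) − 2h_□(x) + h_□(x − e_μ)| ≤ C2F/(8S/5)²` — the shapes of the binders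
`h236`, `hh1`, `hhS`, `hLip`, `hζ0`, `hζ1`, `hζS`, `hgap` (and the raw sizes behind `hcf`, `hc₀`) of `…B6Ineq2134KFamKLevel.h2134_kFam_kLevel` /
`…B6Prop26Gluing.prop26_2136_of_2133_2134`. [cite: Balaban1984PropagatorsII, (2.36) p.229, (2.89)–(2.92) p.239, (2.134) p.247] -/
theorem partition118_fine (hℓ : 1 ≤ ℓ) (hMh : 2 * (ℓ + 1) ≤ Mh) (hP : ∀ μ, 1 ≤ P μ) (hR : 2 * (ℓ + 1) ≤ R) :
    (∀ x : ↥(boxDom (N0 ℓ Mh k P)), ∑ i : ↥(cubes D), hF D i x ^ 2 = 1) ∧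
    (∀ (i : ↥(cubes D)) (x : ↥(boxDom (N0 ℓ Mh k P))), |hF D i x| ≤ 1) ∧
    (∀ (i : ↥(cubes D)) (x : ↥(boxDom (N0 ℓ Mh k P))), hF D i x ≠ 0 → blkOf D x ∈ Q D i) ∧
    (∀ (i : ↥(cubes D)) (x x' : ↥(boxDom (N0 ℓ Mh k P))),
      |hF D i x' - hF D i x| ≤ sLipF d ℓ / (((ℓ : ℝ) + 1) * Mh) * ((geom D).dist (blkOf D x) (blkOf D x') + 1)) ∧
    (∀ (i : ↥(cubes D)) (x : ↥(boxDom (N0 ℓ Mh k P))), 0 ≤ zetaB D i x) ∧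
    (∀ (i : ↥(cubes D)) (x : ↥(boxDom (N0 ℓ Mh k P))), zetaB D i x ≤ 1) ∧
    (∀ (i : ↥(cubes D)) (x : ↥(boxDom (N0 ℓ Mh k P))), zetaB D i x ≠ 1 → blkOf D x ∉ Qbig D i) ∧
    (∀ (i : ↥(cubes D)) (y y'' : ↥(bset D)), y ∉ Qbig D i → y'' ∈ Q D i →
      1 / (4 * ((ℓ : ℝ) + 1)) * (((ℓ : ℝ) + 1) * Mh) ≤ (geom D).dist y y'') ∧
    (∀ (i : ↥(cubes D)) (x x' : ↥(boxDom (N0 ℓ Mh k P))), dist (toR x.1) (toR x'.1) ≤ 1 → |hF D i x' - hF D i x| ≤ C1F d ℓ / sF D i) ∧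
    (∀ (i : ↥(cubes D)) (μ : Fin (d + 1)) (x xp xm : ↥(boxDom (N0 ℓ Mh k P))), xp.1 = Function.update x.1 μ (x.1 μ + 1) →
      xm.1 = Function.update x.1 μ (x.1 μ + (-1)) → |hF D i xp - 2 * hF D i x + hF D i xm| ≤ C2F d ℓ / sF D i ^ 2) := by
  have hMh1 : 1 ≤ Mh := le_trans (by omega) hMh
  have hMh2 : 2 ≤ Mh := le_trans (by omega) hMh
  exact ⟨sum_hF_sq D hMh1, abs_hF_le_one D hMh1, fun _ _ h => blkOf_mem_Q_of_hF_ne_zero D hMh2 hR h,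
    abs_hF_sub_le_geom D hℓ hMh2 hP hR, zetaB_nonneg D, zetaB_le_one D, fun _ _ h => not_mem_Qbig_of_zetaB_ne_one D h,
    fun _ _ _ hy hy'' => gap_Qbig D hMh1 hP hR hy hy'', fun i _ _ h => abs_hF_sub_le_near D hℓ hMh hR i h,
    fun i μ _ _ _ hp hm => abs_hF_second_diff_le D hℓ hMh1 hR i μ hp hm⟩

end Literature.MathematicalPhysics.QuantumFieldTheory.Balaban1983to89.B6Partition118KLevelFineLipL0
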